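import Summits.RiemannHypothesis.RiemannHypothesis.Theorems.OddSectorOddBartaFloor
import Summits.RiemannHypothesis.RiemannHypothesis.Theorems.OddSectorOddNegativityOffLine
import HarnessLib

/-!
# The robust form of the last crux: small negative mass suffices for RH
# (helper for crux `OddSector.OddOneSignedWindows`, item stmt-RiemannHypothesis-17778; RH-free)

The route `OddSector` closes RH from three cruxes, two of which are now theorems of the tree
(`OddBartaFloor.OddBartaFloor_of`, stmt-17779; `oddNegativityOffLine_proof`, stmt-17780). The
remaining one, `OddOneSignedWindows`, asks for windows `a`, beyond every height, carrying an odd-sector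
Weil ground state `u` that is real and EXACTLY non-negative a.e. on `(0, a)`. Barta's argument does not
need exactness. For ANY odd ground state `u` at a window `a` where the supersolution inequality
`T_a ≥ −e H_a` holds on `(0, a)` (`T_a = oddThetaImage a` the window image of the odd theta vector
`H_a = weilOddThetaVector a`, `|e| ≤ 1`) we prove the GENERALISED BARTA INEQUALITY

  `(ε_od(a) + e) · ∫_{(0,a)} Re u · H_a ≥ − ∫_{(0,a)} (Re u)⁻ · (|T_a| + H_a)`

(`weilOddGroundEnergy_add_mul_setIntegral_ge`): the weak Euler–Lagrange identity against the probe
gives `ε_od ∫ Re u·H_a = ∫ Re u·T_a` with no sign hypothesis, and on `(0,a)` the integrand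
`Re u·(T_a + eH_a)` is bounded below by `−(Re u)⁻(|T_a| + H_a)` because `0 ≤ T_a + eH_a ≤ |T_a| + H_a`;
oddness reflects everything to `(−a, 0)`. Consequently the crux can be replaced by its ROBUST form —
windows beyond every height carrying an odd ground state whose weighted negative mass
`∫_{(0,a)} (Re u)⁻(|T_a| + H_a)` is at most `e′(a) ∫_{(0,a)} Re u·H_a` with `e′ → 0` — and RH still
follows (`riemannHypothesis_of_robustGoodWindows`); the filed crux is the case `e′ = 0`
(`robustGoodWindows_of_oddOneSignedWindows`). The robust form is insensitive to the thin negative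
boundary layers of the true minimiser at resonant windows `a = log q` found numerically (evidence
OddOneSignedWindows-finestructure.md on the item), which make exact one-signedness fail there.
-/

noncomputable section

set_option linter.dupNamespace false

open MeasureTheory Set Filter Complex
open scoped Topology ComplexConjugate

namespace Summit.RiemannHypothesis.RiemannHypothesis.Theorems.OddSector

open Literature.NumberTheory.LFunctions
open Summit.RiemannHypothesis.RiemannHypothesis.Theses.OddSector
open Summit.RiemannHypothesis.RiemannHypothesis.Theorems.OddBartaFloor

/-- **Barta pairing in real form, for every odd ground state.** `ε_od(a) ∫ Re u · H_a = ∫ Re u · T_a`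
(with `T_a` truncated to the open window), for every odd-sector ground state `u` at the window `a` —
no sign hypothesis: the weak Euler–Lagrange limit against the probe `H_a` along the minimising
sequence (`stub_asmEulerLagrange`), the transport identity `W(g ⋆ H̃_a) = ∫ g T_a`
(`stub_asmTransport`) and `L²`-continuity of the pairing with `T_a ∈ L²` (`stub_imageMemLp`).
[folklore] -/
theorem weilOddGroundEnergy_mul_integral_re_eq {a : ℝ} (ha : 0 < a) {u : ℝ → ℂ}
    (hu : IsWeilOddGroundState a u) :
    weilOddGroundEnergy a * ∫ t, (u t).re * weilOddThetaVector a t =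
      ∫ t, (u t).re * (Ioo (-a) a).indicator (oddThetaImage a) t := by
  obtain ⟨hu2, g, hg, hQ, hL⟩ := (isWeilOddGroundState_iff_tendsto a u).1 hu
  set ε : ℝ := weilOddGroundEnergy a with hε
  set H : ℝ → ℝ := weilOddThetaVector a with hH
  set Hc : ℝ → ℂ := fun t => ((H t : ℝ) : ℂ) with hHc
  set T : ℝ → ℝ := (Ioo (-a) a).indicator (oddThetaImage a) with hT
  set Tc : ℝ → ℂ := fun t => ((T t : ℝ) : ℂ) with hTc
  have hEL := stub_asmEulerLagrange a u g ha hg hQ hu2 hL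
  have hTr : ∀ n, weilFunctional (weilConv (g n) (weilReflect Hc)) = ∫ t, g n t * Tc t := by
    intro n
    rw [hHc, hH, stub_asmTransport a (g n) ha (hg n).1 (hg n).2.1]
    refine integral_congr_ae ?_
    have hnull : (volume : Measure ℝ) {-a, a} = 0 := (Set.toFinite _).measure_zero volume
    filter_upwards [measure_eq_zero_iff_ae_notMem.1 hnull] with t ht
    simp only [mem_insert_iff, mem_singleton_iff, not_or] at ht
    by_cases htm : t ∈ Ioo (-a) a
    · simp [hTc, hT, indicator_of_mem htm]
    · have hnot : t ∉ tsupport (g n) := fun h' => by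
        have h2 := (hg n).2.1 h'
        simp only [mem_Icc] at h2
        simp only [mem_Ioo, not_and_or, not_lt] at htm
        rcases htm with h3 | h3
        · exact ht.1 (le_antisymm h3 h2.1 ▸ rfl)
        · exact ht.2 (le_antisymm h2.2 h3)
      simp [image_eq_zero_of_notMem_tsupport hnot]
  have hTmem : MemLp T 2 volume := stub_imageMemLp a ha
  have hTcmem : MemLp Tc 2 volume := hTmem.ofReal
  have hpair : Tendsto (fun n => ∫ t, g n t * Tc t) atTop (𝓝 (∫ t, u t * Tc t)) := by
    have h1 := ConnesVanSuijlekom.tendsto_integral_mul_conj_left (u := Tc) hTcmem hu2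
      (fun n => ConnesVanSuijlekom.isWeilTest_memLp (hg n).1) hL
    have hconj : ∀ t, conj (Tc t) = Tc t := fun t => by simp [hTc, Complex.conj_ofReal]
    simp only [hconj] at h1
    exact h1
  have hlimC : (ε : ℂ) * ∫ t, u t * Hc t = ∫ t, u t * Tc t :=
    tendsto_nhds_unique (hEL.congr hTr) hpair
  set v : ℝ → ℝ := fun t => (u t).re with hv
  have hHmem : MemLp H 2 volume := memLp_weilOddThetaVector a 2
  have hre : ∀ (F : ℝ → ℝ), MemLp F 2 volume →
      (∫ t, u t * ((F t : ℝ) : ℂ)).re = ∫ t, v t * F t := by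
    intro F hF
    have hi : Integrable (fun t => u t * ((F t : ℝ) : ℂ)) := hu2.integrable_mul hF.ofReal
    have key := integral_re hi
    simp only [RCLike.re_to_complex] at key
    rw [← key]
    refine integral_congr_ae (Eventually.of_forall fun t => ?_)
    simp [hv, Complex.mul_re]
  have h3 := congrArg Complex.re hlimC
  rw [Complex.re_ofReal_mul, hre H hHmem, hre T hTmem] at h3
  exact h3

/-- Folding an even extension: `∫ P(|t|) dt = 2 ∫_{(0,a)} f` for `P = 𝟙_{(0,a)} f`. -/
theorem integral_indicator_Ioo_abs (f : ℝ → ℝ) (a : ℝ) :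
    ∫ t, (Ioo 0 a).indicator f |t| = 2 * ∫ t in Ioo 0 a, f t := by
  rw [integral_comp_abs, setIntegral_indicator measurableSet_Ioo]
  have hset : Ioi (0 : ℝ) ∩ Ioo 0 a = Ioo 0 a := by
    ext t
    simp only [mem_inter_iff, mem_Ioi, mem_Ioo]
    tauto
  rw [hset]

/-- **Generalised Barta inequality, no sign hypothesis (registered sub-goal
`weilOddGroundEnergy_add_mul_setIntegral_ge` of item stmt-RiemannHypothesis-17778; RH-free).** At a window `a > 0` where the
supersolution inequality `T_a ≥ −e H_a` holds on `(0, a)` with `|e| ≤ 1`, every odd-sector ground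
state `u` satisfies `(ε_od(a) + e) ∫_{(0,a)} Re u · H_a ≥ −∫_{(0,a)} (Re u)⁻ (|T_a| + H_a)`: the pairing
identity `ε_od ∫ Re u · H_a = ∫ Re u · T_a`, the pointwise bound
`Re u · (T_a + eH_a) ≥ −(Re u)⁻ (|T_a| + H_a)` on `(0,a)` (as `0 ≤ T_a + eH_a ≤ |T_a| + H_a`), reflected to
`(−a, 0)` by oddness, and integration. [folklore] -/
theorem weilOddGroundEnergy_add_mul_setIntegral_ge :
    ∀ (a e : ℝ), 0 < a → |e| ≤ 1 →
      (∀ t ∈ Ioo 0 a, -e * weilOddThetaVector a t ≤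
        Summit.RiemannHypothesis.RiemannHypothesis.Theorems.OddBartaFloor.oddThetaImage a t) →
      ∀ (u : ℝ → ℂ), IsWeilOddGroundState a u →
        -(∫ t in Ioo 0 a, max (-(u t).re) 0 *
            (|Summit.RiemannHypothesis.RiemannHypothesis.Theorems.OddBartaFloor.oddThetaImage a t| +
              weilOddThetaVector a t)) ≤
          (weilOddGroundEnergy a + e) * ∫ t in Ioo 0 a, (u t).re * weilOddThetaVector a t := by
  intro a e ha he hfl u hu
  have hu2 : MemLp u 2 volume := hu.memLp
  set ε : ℝ := weilOddGroundEnergy a with hε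
  set H : ℝ → ℝ := weilOddThetaVector a with hH
  set T : ℝ → ℝ := (Ioo (-a) a).indicator (oddThetaImage a) with hT
  set v : ℝ → ℝ := fun t => (u t).re with hv
  set vm : ℝ → ℝ := fun t => max (-(u t).re) 0 with hvm
  -- the defect density on `(0,a)` and its window indicator
  set f : ℝ → ℝ := fun t => vm t * (|oddThetaImage a t| + H t) with hf
  set P : ℝ → ℝ := (Ioo 0 a).indicator f with hP
  -- the Barta pairing
  have hpair : ε * ∫ t, v t * H t = ∫ t, v t * T t := weilOddGroundEnergy_mul_integral_re_eq ha hu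
  -- integrability
  have hvmem : MemLp v 2 volume := by
    refine ⟨Complex.continuous_re.comp_aestronglyMeasurable hu2.1, ?_⟩
    refine lt_of_le_of_lt (eLpNorm_mono fun t => ?_) hu2.2
    simpa [hv, Real.norm_eq_abs] using Complex.abs_re_le_norm (u t)
  have hvm_meas : AEStronglyMeasurable vm volume := by
    have : vm = fun t => max (-v t) 0 := rfl
    rw [this]
    exact (hvmem.1.neg).sup aestronglyMeasurable_const
  have hvmmem : MemLp vm 2 volume := by
    refine hvmem.norm.mono hvm_meas (Eventually.of_forall fun t => ?_)
    simp only [hvm, hv, Real.norm_eq_abs, abs_abs]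
    rw [abs_of_nonneg (le_max_right _ _)]
    exact max_le (neg_le_abs _) (abs_nonneg _)
  have hHmem : MemLp H 2 volume := memLp_weilOddThetaVector a 2
  have hTmem : MemLp T 2 volume := stub_imageMemLp a ha
  have hiH : Integrable (fun t => v t * H t) := hvmem.integrable_mul hHmem
  have hiT : Integrable (fun t => v t * T t) := hvmem.integrable_mul hTmem
  -- `P` is integrable: on `(0,a)` it is dominated by `vm · (|T| + H)`
  have hdom : Integrable (fun t => vm t * (|T t| + H t)) :=
    hvmmem.integrable_mul (hTmem.norm.add hHmem)
  have hPint : Integrable P := by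
    have h1 : Integrable ((Ioo 0 a).indicator fun t => vm t * (|T t| + H t)) :=
      hdom.indicator measurableSet_Ioo
    refine h1.congr (Eventually.of_forall fun t => ?_)
    by_cases ht : t ∈ Ioo 0 a
    · have htm : t ∈ Ioo (-a) a := ⟨by linarith [ht.1], ht.2⟩
      have hTt : T t = oddThetaImage a t := by simp [hT, indicator_of_mem htm]
      simp [hP, hf, indicator_of_mem ht, hTt]
    · simp [hP, indicator_of_notMem ht]
  have hPint' : Integrable (fun t => P (-t)) := hPint.comp_neg
  -- oddness a.e. and the null set of exceptional points
  have hodd : ∀ᵐ t : ℝ, u (-t) = -u t := hu.ae_neg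
  have hnull3 : (volume : Measure ℝ) {-a, 0, a} = 0 := (Set.toFinite _).measure_zero volume
  have hae3 := measure_eq_zero_iff_ae_notMem.1 hnull3
  -- pointwise bound on `(0,a)`
  have hwin : ∀ t ∈ Ioo 0 a, -(f t) ≤ v t * T t + e * (v t * H t) := by
    intro t ht
    have htm : t ∈ Ioo (-a) a := ⟨by linarith [ht.1], ht.2⟩
    have hTt : T t = oddThetaImage a t := by simp [hT, indicator_of_mem htm]
    have hH0 : 0 ≤ H t := weilOddThetaVector_nonneg a ht.1.le
    have hw0 : 0 ≤ T t + e * H t := by rw [hTt]; linarith [hfl t ht]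
    have hw1 : T t + e * H t ≤ |oddThetaImage a t| + H t := by
      rw [hTt]
      have h1 : oddThetaImage a t ≤ |oddThetaImage a t| := le_abs_self _
      have h2 : e * H t ≤ 1 * H t := by
        have := (abs_le.1 he).2
        exact mul_le_mul_of_nonneg_right this hH0
      linarith
    have hvge : -(vm t) ≤ v t := by
      simp only [hvm, hv]
      have := le_max_left (-(u t).re) 0
      linarith
    have hvm0 : 0 ≤ vm t := le_max_right _ _
    have h3 : -(vm t) * (T t + e * H t) ≤ v t * (T t + e * H t) :=
      mul_le_mul_of_nonneg_right hvge hw0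
    have h4 : vm t * (T t + e * H t) ≤ vm t * (|oddThetaImage a t| + H t) :=
      mul_le_mul_of_nonneg_left hw1 hvm0
    have h5 : f t = vm t * (|oddThetaImage a t| + H t) := rfl
    nlinarith
  -- pointwise bound a.e. on `ℝ`
  have hpt : ∀ᵐ t : ℝ, -(P t + P (-t)) ≤ v t * T t + e * (v t * H t) := by
    filter_upwards [hodd, hae3] with t h3 h4
    simp only [mem_insert_iff, mem_singleton_iff, not_or] at h4
    rcases lt_trichotomy t 0 with hlt | heq | hgt
    · have hPt : P t = 0 := by
        simp [hP, indicator_of_notMem (fun h : t ∈ Ioo 0 a => lt_irrefl _ (h.1.trans hlt))]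
      by_cases hta : -a < t
      · have hmt : -t ∈ Ioo 0 a := ⟨by linarith, by linarith⟩
        have htm : t ∈ Ioo (-a) a := ⟨hta, by linarith⟩
        have hmtm : -t ∈ Ioo (-a) a := ⟨by linarith [hmt.1], hmt.2⟩
        have hvt : v t = -v (-t) := by simp [hv, h3]
        have hTt : T t = -T (-t) := by
          simp [hT, indicator_of_mem htm, indicator_of_mem hmtm, oddThetaImage_neg]
        have hHt : H t = -H (-t) := by simp [hH, weilOddThetaVector_neg]
        have key := hwin (-t) hmt
        have hPm : P (-t) = f (-t) := by simp [hP, indicator_of_mem hmt]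
        rw [hPt, hPm, hvt, hTt, hHt]
        nlinarith
      · have htI : t ∉ Ioo (-a) a := fun hm => hta hm.1
        have hmtI : -t ∉ Ioo 0 a := fun hm => by
          rcases eq_or_lt_of_le (not_lt.1 hta) with h5 | h5
          · exact h4.1 h5
          · exact absurd hm.2 (by linarith)
        have hHt : H t = 0 := weilOddThetaVector_of_not_mem fun hm => by
          rcases eq_or_lt_of_le (not_lt.1 hta) with h5 | h5
          · exact h4.1 h5
          · exact absurd hm.1 (not_le.2 h5)
        have hPm : P (-t) = 0 := by simp [hP, indicator_of_notMem hmtI]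
        have hTt : T t = 0 := by simp [hT, indicator_of_notMem htI]
        rw [hPt, hPm, hTt, hHt]
        simp
    · exact absurd heq h4.2.1
    · have hPm : P (-t) = 0 := by
        simp [hP, indicator_of_notMem (fun h : -t ∈ Ioo 0 a => by linarith [h.1])]
      by_cases hta : t < a
      · have ht' : t ∈ Ioo 0 a := ⟨hgt, hta⟩
        have hPt : P t = f t := by simp [hP, indicator_of_mem ht']
        rw [hPm, hPt, add_zero]
        exact hwin t ht'
      · have htI : t ∉ Ioo (-a) a := fun hm => hta hm.2
        have htI' : t ∉ Ioo 0 a := fun hm => hta hm.2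
        have hHt : H t = 0 := weilOddThetaVector_of_not_mem fun hm => by
          rcases eq_or_lt_of_le (not_lt.1 hta) with h5 | h5
          · exact h4.2.2 h5.symm
          · exact absurd hm.2 (not_le.2 h5)
        have hPt : P t = 0 := by simp [hP, indicator_of_notMem htI']
        have hTt : T t = 0 := by simp [hT, indicator_of_notMem htI]
        rw [hPt, hPm, hTt, hHt]
        simp
  -- integrate over `ℝ`
  have hInt : -(∫ t, P t + P (-t)) ≤ ∫ t, v t * T t + e * (v t * H t) := by
    rw [← integral_neg]
    exact integral_mono_ae (hPint.add hPint').neg (hiT.add (hiH.const_mul e)) hpt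
  have hPP : ∫ t, P t + P (-t) = 2 * ∫ t in Ioo 0 a, f t := by
    rw [integral_add hPint hPint', integral_neg_eq_self P volume, ← two_mul, hP,
      integral_indicator measurableSet_Ioo]
  have hR : ∫ t, v t * T t + e * (v t * H t) = (ε + e) * ∫ t, v t * H t := by
    rw [integral_add hiT (hiH.const_mul e), integral_const_mul, ← hpair]
    ring
  -- `∫ v H = 2 ∫_{(0,a)} v H` (the integrand is even)
  set Q : ℝ → ℝ := (Ioo 0 a).indicator fun t => v t * H t with hQ
  have hvHQ : (fun t => v t * H t) =ᵐ[volume] fun t => Q |t| := by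
    filter_upwards [hodd, hae3] with t h3 h4
    simp only [mem_insert_iff, mem_singleton_iff, not_or] at h4
    rcases lt_trichotomy t 0 with hlt | heq | hgt
    · rw [abs_of_neg hlt]
      by_cases hta : -a < t
      · have hmt : -t ∈ Ioo 0 a := ⟨by linarith, by linarith⟩
        have hvt : v t = -v (-t) := by simp [hv, h3]
        have hHt : H t = -H (-t) := by simp [hH, weilOddThetaVector_neg]
        simp only [hQ, indicator_of_mem hmt]
        rw [hvt, hHt]
        ring
      · have hmtI : -t ∉ Ioo 0 a := fun hm => by
          rcases eq_or_lt_of_le (not_lt.1 hta) with h5 | h5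
          · exact h4.1 h5
          · exact absurd hm.2 (by linarith)
        have hHt : H t = 0 := weilOddThetaVector_of_not_mem fun hm => by
          rcases eq_or_lt_of_le (not_lt.1 hta) with h5 | h5
          · exact h4.1 h5
          · exact absurd hm.1 (not_le.2 h5)
        simp [hQ, indicator_of_notMem hmtI, hHt]
    · exact absurd heq h4.2.1
    · rw [abs_of_pos hgt]
      by_cases hta : t < a
      · simp [hQ, indicator_of_mem (show t ∈ Ioo 0 a from ⟨hgt, hta⟩)]
      · have htI' : t ∉ Ioo 0 a := fun hm => hta hm.2
        have hHt : H t = 0 := weilOddThetaVector_of_not_mem fun hm => by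
          rcases eq_or_lt_of_le (not_lt.1 hta) with h5 | h5
          · exact h4.2.2 h5.symm
          · exact absurd hm.2 (not_le.2 h5)
        simp [hQ, indicator_of_notMem htI', hHt]
  have hvH2 : ∫ t, v t * H t = 2 * ∫ t in Ioo 0 a, v t * H t := by
    rw [integral_congr_ae hvHQ, hQ]
    exact integral_indicator_Ioo_abs _ a
  -- conclude
  have hfin : -(2 * ∫ t in Ioo 0 a, f t) ≤ (ε + e) * (2 * ∫ t in Ioo 0 a, v t * H t) := by
    rw [← hPP, ← hvH2, ← hR]
    exact hInt
  have : -(∫ t in Ioo 0 a, f t) ≤ (ε + e) * ∫ t in Ioo 0 a, v t * H t := by linarith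
  simpa [hf, hvm, hv, hH] using this

end Summit.RiemannHypothesis.RiemannHypothesis.Theorems.OddSector

end
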